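import Summits.QuantumFields.BalabanUV.Beta.GAN24.FibreSymbols
import Summits.QuantumFields.BalabanUV.Beta.GAN24.AliasWeights

/-!
# `BalabanUV.Beta.GAN24.AliasWeightsSum` — binder row G-an2-4 / (CONV-C), road P1-fibre, leaf **P1-L06** (node A2 / N06 of
# `SKELETON-P1.md`), part 2 of 2: the real Laplacian symbol and the UNIFORM ALIAS-SUM BOUND

NOT IN PRINT; OUR PROOF ATTEMPT.  HONEST FRAMING (cell contract, verbatim): «discharging `BetaPertH` makes Bałaban's UV stability
UNCONDITIONAL — a real constructive-QFT result; it is NOT the continuum limit and NOT the Clay problem.»  HONEST DEPENDENCY (verbatim):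
«continuum YM on T⁴ ⇐ BetaPertH ∧ nine spine estimates (0/9 proved); BetaPertH ⇐ (D1) ∧ (D4) ∧ CAP+tail; G-an2-4 gates asym, D1 and
NE2/3/4.»  [folklore] explicit analysis; discharges NOTHING of (CONV-C) by itself (weight bookkeeping for leaves P1-L05/L08/L09/L11).
NOT `BetaPertH`, NOT continuum, NOT Clay.  No `def … : Prop`, no cited fact, no wall binder.

## What is proved (Mathlib + part 1 `GAN24/AliasWeights`; every constant explicit)
* `lapR k = Σ_i 4 sin²(k_i/2)` and the DICTIONARY `lapSym_ofReal`: `FibreSymbols.lapSym` at a real momentum is `lapR` (as a real number);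
  `sq_mul_lapR`: `N²·lapR k = Σ_i 4 (N sin(k_i/2))²`; a NONZERO alias coordinate gives `4·min(val, N−val)² ≤ N²·lapR k_m`
  (`four_mul_fold_sq_le_sq_mul_lapR`), in particular `4 ≤ N²·lapR k_m` for `m ≠ 0` (`four_le_sq_mul_lapR`).
* the summand `aliasWtTerm N p m = (Π_i sinWt N k_{m,i}) / (N²·lapR k_m)` and its termwise majorisation by `Π_i wMaj N (m i) / (4B)`
  whenever `4B ≤ N²·lapR k_m` (`aliasWtTerm_le_prod_wMaj_div`);
* one-coordinate sums `Σ_{r≠0} val(r)⁻² ≤ 2`, `Σ_{r≠0} (N − val r)⁻² ≤ 2` (Mathlib `sum_Ioo_inv_sq_le`), `Σ_r wMaj N r ≤ 5`, and the box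
  product formula `Σ_{m≠0} Π_i wMaj N (m i) ≤ 5^D − 1` (`Fintype.prod_sum`; King 1986 (4.22) pattern of `King1986.AliasSums.alias_sum_le`);
* **`alias_sum_le`**: for every `D`, `N ≥ 1`, `p ∈ [−π, π]^D`,
  `Σ_{m ∈ (ℤ/N)^D, m ≠ 0} aliasWtTerm N p m ≤ aliasWtConst D = (5^D − 1)/4` — UNIFORMLY in `N` and `p`;
* **`alias_tail_sum_le`** (input of B2 `alias_tail`): the aliases with a folded coordinate `min(val(m_i), N − val(m_i)) ≥ R ≥ 1`
  contribute at most `aliasWtConst D / R²` (`R ≈ N/(2Lc)` gives the `O(Lc²/N²)` tail).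

Unit `b2b-balaban-gan24-formalise-leaf-17` (G-an2-4 formalisation swarm, leaf prover 17), 2026-08-19.  Value = kernel bookkeeping leaf
toward the K-slot route P1, NOT summit progress.
-/

noncomputable section

open Complex Finset
open scoped BigOperators Real

namespace Summit.QuantumFields.BalabanUV.Beta.GAN24.AliasWeightsSum

open AliasWeights

variable {D : ℕ}

/-! ## §3  The real Laplacian symbol and the uniform alias-sum bound -/

/-- The Laplacian symbol at REAL momentum: `lapR k = Σ_i 4 sin²(k_i/2)` (`= |∂̂(k)|²`). -/
def lapR (k : Fin D → ℝ) : ℝ := ∑ i, 4 * Real.sin (k i / 2) ^ 2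

/-- [folklore] `0 ≤ lapR k`. -/
theorem lapR_nonneg (k : Fin D → ℝ) : 0 ≤ lapR k := Finset.sum_nonneg fun i _ => by positivity

/-- [folklore] DICTIONARY: `FibreSymbols.lapSym` at a real momentum is the real number `lapR k`:
`Σ_κ (e^{ik_κ} − 1)(e^{−ik_κ} − 1) = Σ_κ 4 sin²(k_κ/2)`. -/
theorem lapSym_ofReal (k : Fin D → ℝ) : FibreSymbols.lapSym (fun i => ((k i : ℝ) : ℂ)) = ((lapR k : ℝ) : ℂ) := by
  unfold FibreSymbols.lapSym FibreSymbols.dhat FibreSymbols.dflat lapR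
  push_cast
  refine Finset.sum_congr rfl fun κ _ => ?_
  have h2 : (cexp (I * k κ) - 1) * (cexp (-(I * k κ)) - 1) = 2 - 2 * Complex.cos (k κ) := by
    rw [Complex.cos, show (k κ : ℂ) * I = I * k κ by ring, show -(k κ : ℂ) * I = -(I * k κ) by ring]
    have : cexp (I * k κ) * cexp (-(I * k κ)) = 1 := by rw [← Complex.exp_add, add_neg_cancel, Complex.exp_zero]
    linear_combination this
  have hc : Complex.cos (k κ) = 2 * Complex.cos ((k κ : ℂ) / 2) ^ 2 - 1 := by
    rw [← Complex.cos_two_mul]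
    congr 1
    ring
  rw [h2, hc]
  have := Complex.sin_sq_add_cos_sq ((k κ : ℂ) / 2)
  linear_combination (-4) * this

/-- The SUMMAND of the alias sum: `(Π_i sinWt N k_{m,i}) / (N²·lapR k_m)` — in the units of SKELETON-P1 S1c the `m`-th term of the
transverse alias sum `𝒫(p)/N^{D+4}` is dominated by it (the extra `s_κ s̄_κ` weights are `≤ 1` in these units). -/
def aliasWtTerm (N : ℕ) (p : Fin D → ℝ) (m : Fin D → ZMod N) : ℝ :=
  (∏ i, sinWt N (kfine N p m i)) / ((N : ℝ) ^ 2 * lapR (kfine N p m))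

/-- [folklore] `0 ≤ aliasWtTerm N p m`. -/
theorem aliasWtTerm_nonneg (N : ℕ) (p : Fin D → ℝ) (m : Fin D → ZMod N) : 0 ≤ aliasWtTerm N p m :=
  div_nonneg (Finset.prod_nonneg fun _ _ => (sinWt_pos _ _).le) (mul_nonneg (sq_nonneg _) (lapR_nonneg _))

/-- [folklore] `N²·lapR k = Σ_i 4·(N·sin(k_i/2))²`. -/
theorem sq_mul_lapR (N : ℕ) (k : Fin D → ℝ) :
    (N : ℝ) ^ 2 * lapR k = ∑ i, 4 * ((N : ℝ) * |Real.sin (k i / 2)|) ^ 2 := by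
  unfold lapR
  rw [Finset.mul_sum]
  refine Finset.sum_congr rfl fun i _ => ?_
  rw [mul_pow, sq_abs]
  ring

/-- [folklore] A NONZERO alias coordinate makes the Laplacian symbol uniformly large:
`4·min(val(m_i), N − val(m_i))² ≤ N²·lapR k_m` for `m i ≠ 0`, `|p_j| ≤ π`. -/
theorem four_mul_fold_sq_le_sq_mul_lapR {N : ℕ} [NeZero N] {p : Fin D → ℝ} (hp : ∀ i, |p i| ≤ π)
    (m : Fin D → ZMod N) {i : Fin D} (hi : m i ≠ 0) :
    4 * (((min (m i).val (N - (m i).val) : ℕ) : ℝ)) ^ 2 ≤ (N : ℝ) ^ 2 * lapR (kfine N p m) := by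
  have hv0 : 1 ≤ (m i).val := Nat.one_le_iff_ne_zero.2 fun h0 => hi ((ZMod.val_eq_zero _).1 h0)
  have hvN : (m i).val + 1 ≤ N := ZMod.val_lt (m i)
  have hfold := fold_le_mul_abs_sin (hp i) hv0 hvN
  rw [sq_mul_lapR]
  calc 4 * (((min (m i).val (N - (m i).val) : ℕ) : ℝ)) ^ 2
      ≤ 4 * ((N : ℝ) * |Real.sin (kfine N p m i / 2)|) ^ 2 := by
        refine mul_le_mul_of_nonneg_left (pow_le_pow_left₀ (Nat.cast_nonneg _) ?_ 2) (by norm_num)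
        simpa [kfine] using hfold
    _ ≤ ∑ j, 4 * ((N : ℝ) * |Real.sin (kfine N p m j / 2)|) ^ 2 :=
        Finset.single_le_sum (f := fun j => 4 * ((N : ℝ) * |Real.sin (kfine N p m j / 2)|) ^ 2)
          (fun j _ => by positivity) (Finset.mem_univ i)

/-- [folklore] In particular `4 ≤ N²·lapR k_m` for every nonzero alias `m` (`p ∈ [−π, π]^D`). -/
theorem four_le_sq_mul_lapR {N : ℕ} [NeZero N] {p : Fin D → ℝ} (hp : ∀ i, |p i| ≤ π)
    {m : Fin D → ZMod N} (hm : m ≠ 0) : 4 ≤ (N : ℝ) ^ 2 * lapR (kfine N p m) := by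
  obtain ⟨i, hi⟩ : ∃ i, m i ≠ 0 := by
    by_contra h
    exact hm (funext fun i => by simpa using (not_exists.1 h) i)
  have hv0 : 1 ≤ (m i).val := Nat.one_le_iff_ne_zero.2 fun h0 => hi ((ZMod.val_eq_zero _).1 h0)
  have hvN : (m i).val + 1 ≤ N := ZMod.val_lt (m i)
  have hf1 : (1 : ℝ) ≤ ((min (m i).val (N - (m i).val) : ℕ) : ℝ) := by exact_mod_cast le_min hv0 (by omega)
  have h := four_mul_fold_sq_le_sq_mul_lapR hp m hi
  nlinarith

/-- [folklore] TERMWISE MAJORISATION with a denominator bound: if `m ≠ 0` and `4B ≤ N²·lapR k_m` for some `B > 0`, then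
`aliasWtTerm N p m ≤ (Π_i wMaj N (m i)) / (4B)`. -/
theorem aliasWtTerm_le_prod_wMaj_div {N : ℕ} [NeZero N] {p : Fin D → ℝ} (hp : ∀ i, |p i| ≤ π)
    (m : Fin D → ZMod N) {B : ℝ} (hB : 0 < B) (hden : 4 * B ≤ (N : ℝ) ^ 2 * lapR (kfine N p m)) :
    aliasWtTerm N p m ≤ (∏ i, wMaj N (m i)) / (4 * B) := by
  unfold aliasWtTerm
  have hP0 : 0 ≤ ∏ i, sinWt N (kfine N p m i) := Finset.prod_nonneg fun i _ => (sinWt_pos _ _).le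
  have hP : ∏ i, sinWt N (kfine N p m i) ≤ ∏ i, wMaj N (m i) :=
    Finset.prod_le_prod (fun i _ => (sinWt_pos _ _).le) fun i _ => sinWt_kfine_le_wMaj hp m i
  calc (∏ i, sinWt N (kfine N p m i)) / ((N : ℝ) ^ 2 * lapR (kfine N p m))
      ≤ (∏ i, sinWt N (kfine N p m i)) / (4 * B) := div_le_div_of_nonneg_left hP0 (by positivity) hden
    _ ≤ (∏ i, wMaj N (m i)) / (4 * B) := div_le_div_of_nonneg_right hP (by positivity)

/-- [folklore] `Σ_{r ≠ 0} val(r)⁻² ≤ 2` over `ℤ/N` (`val` is injective into `(0, N)`; Mathlib `sum_Ioo_inv_sq_le`). -/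
theorem sum_inv_val_sq_le (N : ℕ) [NeZero N] :
    ∑ r ∈ (Finset.univ : Finset (ZMod N)).erase 0, ((r.val : ℝ) ^ 2)⁻¹ ≤ 2 := by
  classical
  have hinj : Set.InjOn (fun r : ZMod N => r.val) ↑((Finset.univ : Finset (ZMod N)).erase 0) :=
    fun a _ b _ h => ZMod.val_injective N h
  have himg := Finset.sum_image (f := fun v : ℕ => ((v : ℝ) ^ 2)⁻¹) hinj
  rw [← himg]
  have hsub : ((Finset.univ : Finset (ZMod N)).erase 0).image (fun r : ZMod N => r.val) ⊆ Finset.Ioo 0 N := by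
    intro v hv
    rw [Finset.mem_image] at hv
    obtain ⟨r, hr, rfl⟩ := hv
    rw [Finset.mem_Ioo]
    exact ⟨Nat.pos_of_ne_zero fun h => (Finset.mem_erase.1 hr).1 ((ZMod.val_eq_zero r).1 h), ZMod.val_lt r⟩
  calc ∑ v ∈ ((Finset.univ : Finset (ZMod N)).erase 0).image (fun r : ZMod N => r.val), ((v : ℝ) ^ 2)⁻¹
      ≤ ∑ v ∈ Finset.Ioo 0 N, ((v : ℝ) ^ 2)⁻¹ :=
        Finset.sum_le_sum_of_subset_of_nonneg hsub fun v _ _ => by positivity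
    _ ≤ 2 / ((0 : ℕ) + 1 : ℝ) := by exact_mod_cast sum_Ioo_inv_sq_le (α := ℝ) 0 N
    _ = 2 := by norm_num

/-- [folklore] `Σ_{r ≠ 0} (N − val(r))⁻² ≤ 2` over `ℤ/N` (the reflected window). -/
theorem sum_inv_sub_val_sq_le (N : ℕ) [NeZero N] :
    ∑ r ∈ (Finset.univ : Finset (ZMod N)).erase 0, ((((N - r.val : ℕ) : ℝ)) ^ 2)⁻¹ ≤ 2 := by
  classical
  have hinj : Set.InjOn (fun r : ZMod N => N - r.val) ↑((Finset.univ : Finset (ZMod N)).erase 0) := by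
    intro a _ b _ h
    have ha := ZMod.val_lt a
    have hb := ZMod.val_lt b
    have hab : a.val = b.val := by
      simp only at h
      omega
    exact ZMod.val_injective N hab
  have himg := Finset.sum_image (f := fun v : ℕ => ((v : ℝ) ^ 2)⁻¹) hinj
  rw [← himg]
  have hsub : ((Finset.univ : Finset (ZMod N)).erase 0).image (fun r : ZMod N => N - r.val) ⊆ Finset.Ioo 0 N := by
    intro v hv
    rw [Finset.mem_image] at hv
    obtain ⟨r, hr, rfl⟩ := hv
    rw [Finset.mem_Ioo]
    have h1 := ZMod.val_lt r
    have h2 : r.val ≠ 0 := fun h => (Finset.mem_erase.1 hr).1 ((ZMod.val_eq_zero r).1 h)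
    omega
  calc ∑ v ∈ ((Finset.univ : Finset (ZMod N)).erase 0).image (fun r : ZMod N => N - r.val), ((v : ℝ) ^ 2)⁻¹
      ≤ ∑ v ∈ Finset.Ioo 0 N, ((v : ℝ) ^ 2)⁻¹ :=
        Finset.sum_le_sum_of_subset_of_nonneg hsub fun v _ _ => by positivity
    _ ≤ 2 / ((0 : ℕ) + 1 : ℝ) := by exact_mod_cast sum_Ioo_inv_sq_le (α := ℝ) 0 N
    _ = 2 := by norm_num

/-- [folklore] ONE-COORDINATE SUM of the majorant: `Σ_{r ∈ ℤ/N} wMaj N r ≤ 5`, uniformly in `N`. -/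
theorem sum_wMaj_le (N : ℕ) [NeZero N] : ∑ r : ZMod N, wMaj N r ≤ 5 := by
  classical
  rw [← Finset.add_sum_erase _ _ (Finset.mem_univ (0 : ZMod N)), wMaj_zero]
  have h : ∑ r ∈ (Finset.univ : Finset (ZMod N)).erase 0, wMaj N r
      = ∑ r ∈ (Finset.univ : Finset (ZMod N)).erase 0, (((r.val : ℝ) ^ 2)⁻¹ + ((((N - r.val : ℕ) : ℝ)) ^ 2)⁻¹) := by
    refine Finset.sum_congr rfl fun r hr => ?_
    rw [wMaj, if_neg (Finset.mem_erase.1 hr).1]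
  rw [h, Finset.sum_add_distrib]
  linarith [sum_inv_val_sq_le N, sum_inv_sub_val_sq_le N]

/-- The explicit constant of the alias-sum bound: `aliasWtConst D = (5^D − 1)/4` (`= 156` for `D = 4`). -/
def aliasWtConst (D : ℕ) : ℝ := ((5 : ℝ) ^ D - 1) / 4

/-- [folklore] The box sum of the majorant products without the zero alias: `Σ_{m ≠ 0} Π_i wMaj N (m i) ≤ 5^D − 1`
(product formula `Π_i Σ_r = Σ_m Π_i`, minus the `m = 0` term `= 1`). -/
theorem sum_prod_wMaj_le (N : ℕ) [NeZero N] :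
    ∑ m ∈ (Finset.univ : Finset (Fin D → ZMod N)).erase 0, ∏ i, wMaj N (m i) ≤ (5 : ℝ) ^ D - 1 := by
  classical
  rw [Finset.sum_erase_eq_sub (Finset.mem_univ _)]
  have h0 : ∏ i : Fin D, wMaj N ((0 : Fin D → ZMod N) i) = 1 := by simp
  rw [h0, ← Fintype.prod_sum (fun (_ : Fin D) (r : ZMod N) => wMaj N r)]
  have h5 : ∏ _i : Fin D, ∑ r : ZMod N, wMaj N r ≤ (5 : ℝ) ^ D := by
    calc ∏ _i : Fin D, ∑ r : ZMod N, wMaj N r ≤ ∏ _i : Fin D, (5 : ℝ) :=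
          Finset.prod_le_prod (fun i _ => Finset.sum_nonneg fun r _ => wMaj_nonneg N r) fun i _ => sum_wMaj_le N
      _ = (5 : ℝ) ^ D := by rw [Finset.prod_const, Finset.card_univ, Fintype.card_fin]
  linarith

/-- **UNIFORM ALIAS-SUM BOUND (leaf P1-L06 / A2).**  For every dimension `D`, box side `N ≥ 1` and Brillouin momentum
`p ∈ [−π, π]^D`:  `Σ_{m ∈ (ℤ/N)^D, m ≠ 0} (Π_i min(1, (N sin(k_{m,i}/2))⁻²)) / (N²·Σ_i 4 sin²(k_{m,i}/2)) ≤ (5^D − 1)/4`,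
`k_{m,i} = (p_i + 2π val(m_i))/N` — uniformly in `N` and `p`.  [folklore; King 1986 (4.22) pattern] -/
theorem alias_sum_le (N : ℕ) [NeZero N] {p : Fin D → ℝ} (hp : ∀ i, |p i| ≤ π) :
    ∑ m ∈ (Finset.univ : Finset (Fin D → ZMod N)).erase 0, aliasWtTerm N p m ≤ aliasWtConst D := by
  classical
  have hterm : ∀ m ∈ (Finset.univ : Finset (Fin D → ZMod N)).erase 0,
      aliasWtTerm N p m ≤ (∏ i, wMaj N (m i)) / (4 * 1) := fun m hm =>
    aliasWtTerm_le_prod_wMaj_div hp m one_pos (by simpa using four_le_sq_mul_lapR hp (Finset.mem_erase.1 hm).1)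
  calc ∑ m ∈ (Finset.univ : Finset (Fin D → ZMod N)).erase 0, aliasWtTerm N p m
      ≤ ∑ m ∈ (Finset.univ : Finset (Fin D → ZMod N)).erase 0, (∏ i, wMaj N (m i)) / (4 * 1) := Finset.sum_le_sum hterm
    _ = (∑ m ∈ (Finset.univ : Finset (Fin D → ZMod N)).erase 0, ∏ i, wMaj N (m i)) / 4 := by
        rw [mul_one, Finset.sum_div]
    _ ≤ ((5 : ℝ) ^ D - 1) / 4 := div_le_div_of_nonneg_right (sum_prod_wMaj_le N) (by norm_num)
    _ = aliasWtConst D := rfl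

/-- **ALIAS TAIL (input of B2 `alias_tail`).**  The aliases with some folded coordinate `min(val(m_i), N − val(m_i)) ≥ R`
(`R ≥ 1`) contribute at most `aliasWtConst D / R²`: their Laplacian symbol is `N²·lapR k_m ≥ 4R²`.  With `R ≈ N/(2Lc)` this is the
`O(Lc²/N²)` tail of SKELETON-P1 B2. [folklore] -/
theorem alias_tail_sum_le (N : ℕ) [NeZero N] {p : Fin D → ℝ} (hp : ∀ i, |p i| ≤ π) {R : ℕ} (hR : 1 ≤ R) :
    ∑ m ∈ (Finset.univ : Finset (Fin D → ZMod N)).filter (fun m => ∃ i, R ≤ min (m i).val (N - (m i).val)),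
      aliasWtTerm N p m ≤ aliasWtConst D / (R : ℝ) ^ 2 := by
  classical
  set S := (Finset.univ : Finset (Fin D → ZMod N)).filter (fun m => ∃ i, R ≤ min (m i).val (N - (m i).val)) with hS
  have hR0 : (0 : ℝ) < R := by exact_mod_cast hR
  -- on S the denominator is ≥ 4R²
  have hterm : ∀ m ∈ S, aliasWtTerm N p m ≤ (∏ i, wMaj N (m i)) / (4 * (R : ℝ) ^ 2) := by
    intro m hm
    obtain ⟨i, hi⟩ := (Finset.mem_filter.1 hm).2
    have hmi : m i ≠ 0 := by
      intro h0
      rw [h0, ZMod.val_zero] at hi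
      simp at hi
      omega
    refine aliasWtTerm_le_prod_wMaj_div hp m (pow_pos hR0 2) ?_
    have h1 := four_mul_fold_sq_le_sq_mul_lapR hp m hmi
    have h2 : (R : ℝ) ^ 2 ≤ (((min (m i).val (N - (m i).val) : ℕ) : ℝ)) ^ 2 :=
      pow_le_pow_left₀ hR0.le (by exact_mod_cast hi) 2
    linarith
  -- S avoids 0 and sits inside univ.erase 0
  have hsub : S ⊆ (Finset.univ : Finset (Fin D → ZMod N)).erase 0 := by
    intro m hm
    rw [Finset.mem_erase]
    refine ⟨?_, Finset.mem_univ _⟩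
    obtain ⟨i, hi⟩ := (Finset.mem_filter.1 hm).2
    intro h0
    rw [h0] at hi
    simp at hi
    omega
  calc ∑ m ∈ S, aliasWtTerm N p m
      ≤ ∑ m ∈ S, (∏ i, wMaj N (m i)) / (4 * (R : ℝ) ^ 2) := Finset.sum_le_sum hterm
    _ ≤ ∑ m ∈ (Finset.univ : Finset (Fin D → ZMod N)).erase 0, (∏ i, wMaj N (m i)) / (4 * (R : ℝ) ^ 2) :=
        Finset.sum_le_sum_of_subset_of_nonneg hsub fun m _ _ =>
          div_nonneg (Finset.prod_nonneg fun i _ => wMaj_nonneg N (m i)) (by positivity)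
    _ = (∑ m ∈ (Finset.univ : Finset (Fin D → ZMod N)).erase 0, ∏ i, wMaj N (m i)) / (4 * (R : ℝ) ^ 2) := by
        rw [Finset.sum_div]
    _ ≤ ((5 : ℝ) ^ D - 1) / (4 * (R : ℝ) ^ 2) := div_le_div_of_nonneg_right (sum_prod_wMaj_le N) (by positivity)
    _ = aliasWtConst D / (R : ℝ) ^ 2 := by rw [aliasWtConst, div_div]

end Summit.QuantumFields.BalabanUV.Beta.GAN24.AliasWeightsSum

end
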